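import Summits.ResolutionOfSingularities.ResolutionOfSingularities.Theorems.RadicialJungCleanModelsGiraudLogJacobianLocalization
import Literature.AlgebraicGeometry.Resolution.GiraudLogJacobianIdeal
import Mathlib.AlgebraicGeometry.IdealSheaf.Basic
import Mathlib.RingTheory.Ideal.MinimalPrime.Noetherian
import Mathlib.RingTheory.Localization.Ideal
import HarnessLib

/-!
# Route `RadicialJung`, crux `CleanModels` (stmt-15917): critical primes on an affine chart —
# T2 brick B3, step (S1e) part 1 (chart-ring algebra)

Support file (OURS) for PROGRAMME-clean-dim2 / T2 (`HOME/L/res-L0-w81-pv-2/g5/S1-SPEC.md`, piece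
S1e), line `via-clean-models` of crux `DescentPerfectToAll` (stmt-0549). Nothing here is a statement
of Hironaka's manuscript.

On an affine open `U = Spec A` of `X` Giraud's critical set `E(f)` (`derivCriticalSet`) and the
vanishing ideal sheaf of the closed set `E(f)` are compared prime by prime:

* `vanishingIdeal_ideal_le_primeIdealOf_iff` — for a closed `Z ⊆ X` and a point `x ∈ U`:
  `(vanishingIdeal Z).ideal U ≤ 𝔭_x ↔ x ∈ Z`; `primeIdealOf_fromSpec`;
* `derivJacobianIdeal_le_primeIdealOf_iff_mem` / `…_le_prime_iff_fromSpec_mem` —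
  `J(A, f|_U) ≤ 𝔭 ↔ fromSpec 𝔭 ∈ E(f)`
  (`Ω[A⁄ℤ]` projective: the stalk is a localisation, `derivJacobianIdeal_eq_map_of_isLocalization`);
* `derivJacobianIdeal_le_prime_iff_vanishingIdeal_le` — hence `J(A, f|_U) ≤ 𝔭 ↔ I_U ≤ 𝔭` with
  `I_U` the ideal of `E(f)` on `U`: the critical height-one primes of the chart are the height-one
  primes over `I_U`;
* `exists_not_mem_and_map_eq_span_away` — pure algebra: if `x ∈ I` and `I·A_𝔮 = (x)·A_𝔮` at a
  prime `𝔮` for a finitely generated ideal `I`, then `I·A[1/e] = (x)·A[1/e]` for some `e ∉ 𝔮`.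

## References
* J. Giraud, Forme normale d'une fonction sur une surface de caractéristique positive, Bull. Soc.
  Math. France 111 (1983) 109–124: Déf. 1.2, 1.3, 2.2. [Giraud1983]
-/

noncomputable section

set_option linter.dupNamespace false -- mandated namespace of this single-conjunct summit

open CategoryTheory AlgebraicGeometry TopologicalSpace IsLocalRing
open Literature.AlgebraicGeometry.Resolution

namespace Summit.ResolutionOfSingularities.ResolutionOfSingularities.Theorems.RadicialJung.CleanModels

open Scheme.IdealSheafData

/-! ## The vanishing ideal of a closed set on an affine chart -/

/-- The prime of `Γ(X, U)` of a point of the form `fromSpec 𝔭` is `𝔭`. [folklore] -/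
theorem primeIdealOf_fromSpec {X : Scheme.{0}} {U : X.Opens} (hU : IsAffineOpen U)
    (𝔭 : PrimeSpectrum Γ(X, U)) (h : hU.fromSpec.base 𝔭 ∈ U) :
    hU.primeIdealOf ⟨hU.fromSpec.base 𝔭, h⟩ = 𝔭 := by
  have h1 : (⟨hU.fromSpec.base 𝔭, h⟩ : U) = hU.isoSpec.inv.base 𝔭 := by
    apply Subtype.ext
    change hU.fromSpec.base 𝔭 = _
    rw [IsAffineOpen.fromSpec, Scheme.Hom.comp_base, TopCat.coe_comp, Function.comp_apply]
    rfl
  rw [IsAffineOpen.primeIdealOf, h1, ← Scheme.Hom.comp_apply, Iso.inv_hom_id]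
  rfl

/-- For a closed `Z ⊆ X`, an affine open `U` and a point `x ∈ U`: the ideal of `Z` on `U` is
contained in the prime of `x` iff `x ∈ Z`. [folklore] -/
theorem vanishingIdeal_ideal_le_primeIdealOf_iff {X : Scheme.{0}} {U : X.Opens} (hU : IsAffineOpen U)
    (Z : Closeds X) {x : X} (hx : x ∈ U) :
    (vanishingIdeal Z).ideal ⟨U, hU⟩ ≤ (hU.primeIdealOf ⟨x, hx⟩).asIdeal ↔ x ∈ (Z : Set X) := by
  rw [vanishingIdeal_ideal]
  change PrimeSpectrum.vanishingIdeal (hU.fromSpec.base ⁻¹' (Z : Set X)) ≤ _ ↔ _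
  have hcl : IsClosed (hU.fromSpec.base ⁻¹' (Z : Set X)) := Z.isClosed.preimage hU.fromSpec.continuous
  have hpt : hU.fromSpec.base (hU.primeIdealOf ⟨x, hx⟩) = x := hU.fromSpec_primeIdealOf ⟨x, hx⟩
  constructor
  · intro h
    have hmem : hU.primeIdealOf ⟨x, hx⟩ ∈ PrimeSpectrum.zeroLocus
        (PrimeSpectrum.vanishingIdeal (hU.fromSpec.base ⁻¹' (Z : Set X)) : Set Γ(X, U)) :=
      (PrimeSpectrum.mem_zeroLocus _ _).mpr h
    rw [PrimeSpectrum.zeroLocus_vanishingIdeal_eq_closure] at hmem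
    have hmem' := hcl.closure_subset hmem
    rw [Set.mem_preimage, hpt] at hmem'
    exact hmem'
  · intro h
    have hmem : hU.primeIdealOf ⟨x, hx⟩ ∈ hU.fromSpec.base ⁻¹' (Z : Set X) := by
      show hU.fromSpec.base (hU.primeIdealOf ⟨x, hx⟩) ∈ (Z : Set X)
      rw [hpt]; exact h
    have hmem' : hU.primeIdealOf ⟨x, hx⟩ ∈ PrimeSpectrum.zeroLocus
        (PrimeSpectrum.vanishingIdeal (hU.fromSpec.base ⁻¹' (Z : Set X)) : Set Γ(X, U)) := by
      rw [PrimeSpectrum.zeroLocus_vanishingIdeal_eq_closure]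
      exact subset_closure hmem
    exact (PrimeSpectrum.mem_zeroLocus _ _).mp hmem'

/-! ## Critical primes of the chart -/

/-- Points of the form `fromSpec 𝔭` lie in the affine open. [folklore] -/
theorem fromSpec_base_mem {X : Scheme.{0}} {U : X.Opens} (hU : IsAffineOpen U)
    (𝔭 : PrimeSpectrum Γ(X, U)) : hU.fromSpec.base 𝔭 ∈ U := by
  have h : hU.fromSpec.base 𝔭 ∈ Set.range hU.fromSpec.base := ⟨𝔭, rfl⟩
  rw [hU.range_fromSpec] at h
  exact h

/-- **`J(A, f|_U) ≤ 𝔭_x ↔ x ∈ E(f)`** for an affine open `U = Spec A` with `Ω[A⁄ℤ]` projective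
and a point `x ∈ U` with prime `𝔭_x`: the stalk at `x` is the localisation `A_{𝔭_x}` and
`J(A_𝔭, f) = J(A, f)·A_𝔭`. [cite: Giraud1983, Déf. 1.2] -/
theorem derivJacobianIdeal_le_primeIdealOf_iff_mem {X : Scheme.{0}} {U : X.Opens}
    (hU : IsAffineOpen U) [Module.Projective Γ(X, U) Ω[Γ(X, U)⁄ℤ]] (f : Γ(X, ⊤)) {x : X}
    (hx : x ∈ U) :
    derivJacobianIdeal Γ(X, U) (X.presheaf.map (homOfLE le_top).op f) ≤
        (hU.primeIdealOf ⟨x, hx⟩).asIdeal ↔ x ∈ derivCriticalSet X f := by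
  letI := TopCat.Presheaf.algebra_section_stalk X.presheaf (⟨x, hx⟩ : U)
  haveI := hU.isLocalization_stalk ⟨x, hx⟩
  set 𝔭 := (hU.primeIdealOf ⟨x, hx⟩).asIdeal with h𝔭
  have hgerm : algebraMap Γ(X, U) (X.presheaf.stalk x)
      (X.presheaf.map (homOfLE le_top).op f) = X.presheaf.germ ⊤ x trivial f :=
    X.presheaf.germ_res_apply (homOfLE le_top) _ hx f
  rw [derivCriticalSet, Set.mem_setOf_eq, ← hgerm,
    derivJacobianIdeal_eq_map_of_isLocalization (X.presheaf.stalk x) 𝔭.primeCompl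
      (X.presheaf.map (homOfLE le_top).op f)]
  constructor
  · intro h
    rw [← IsLocalization.AtPrime.map_eq_maximalIdeal 𝔭 (X.presheaf.stalk x)]
    exact Ideal.map_mono h
  · intro h a ha
    have := h (Ideal.mem_map_of_mem (algebraMap Γ(X, U) _) ha)
    exact (IsLocalization.AtPrime.to_map_mem_maximal_iff _ 𝔭 a).mp this

/-- Prime form: **`J(A, f|_U) ≤ 𝔭 ↔ fromSpec 𝔭 ∈ E(f)`**. [cite: Giraud1983, Déf. 1.2] -/
theorem derivJacobianIdeal_le_prime_iff_fromSpec_mem {X : Scheme.{0}} {U : X.Opens}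
    (hU : IsAffineOpen U) [Module.Projective Γ(X, U) Ω[Γ(X, U)⁄ℤ]] (f : Γ(X, ⊤))
    (𝔭 : PrimeSpectrum Γ(X, U)) :
    derivJacobianIdeal Γ(X, U) (X.presheaf.map (homOfLE le_top).op f) ≤ 𝔭.asIdeal ↔
      hU.fromSpec.base 𝔭 ∈ derivCriticalSet X f := by
  rw [← derivJacobianIdeal_le_primeIdealOf_iff_mem hU f (fromSpec_base_mem hU 𝔭),
    primeIdealOf_fromSpec hU 𝔭]

/-- **The critical height-one primes of the chart are the height-one primes over the ideal of
`E(f)`**: for `E(f)` closed and `Ω[A⁄ℤ]` projective, `J(A, f|_U) ≤ 𝔭 ↔ I_U ≤ 𝔭` for every prime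
`𝔭` of `A = Γ(X, U)`, `I_U = (vanishingIdeal E(f)).ideal U`. [cite: Giraud1983, 1.3] -/
theorem derivJacobianIdeal_le_prime_iff_vanishingIdeal_le {X : Scheme.{0}} {U : X.Opens}
    (hU : IsAffineOpen U) [Module.Projective Γ(X, U) Ω[Γ(X, U)⁄ℤ]] (f : Γ(X, ⊤))
    (hE : IsClosed (derivCriticalSet X f)) (𝔭 : PrimeSpectrum Γ(X, U)) :
    derivJacobianIdeal Γ(X, U) (X.presheaf.map (homOfLE le_top).op f) ≤ 𝔭.asIdeal ↔
      (vanishingIdeal ⟨derivCriticalSet X f, hE⟩).ideal ⟨U, hU⟩ ≤ 𝔭.asIdeal := by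
  rw [← primeIdealOf_fromSpec hU 𝔭 (fromSpec_base_mem hU 𝔭),
    derivJacobianIdeal_le_primeIdealOf_iff_mem hU f (fromSpec_base_mem hU 𝔭),
    vanishingIdeal_ideal_le_primeIdealOf_iff hU ⟨derivCriticalSet X f, hE⟩ (fromSpec_base_mem hU 𝔭)]
  rfl

/-! ## Spreading an equality of ideals from a prime to a basic open -/

/-- **From `A_𝔮` to `A[1/e]`.** If `x ∈ I`, `I` is finitely generated and `I·S = (x)·S` in a
localisation `S = A_𝔮` at the prime `𝔮`, then for some `e ∉ 𝔮`, in every localisation `T` away from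
`e`: `I·T = (x)·T`. [folklore] -/
theorem exists_not_mem_and_map_eq_span_away {A : Type*} [CommRing A] (𝔮 : Ideal A) [𝔮.IsPrime]
    (S : Type*) [CommRing S] [Algebra A S] [IsLocalization.AtPrime S 𝔮] {I : Ideal A} (hI : I.FG)
    {x : A} (hx : x ∈ I) (h : I.map (algebraMap A S) = Ideal.span {algebraMap A S x}) :
    ∃ e ∉ 𝔮, ∀ (T : Type*) [CommRing T] [Algebra A T] [IsLocalization.Away e T],
      I.map (algebraMap A T) = Ideal.span {algebraMap A T x} := by
  classical
  obtain ⟨s, hs⟩ := hI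
  -- each generator `g` has `c_g • g ∈ (x)` for some `c_g ∉ 𝔮`
  have hgen : ∀ g ∈ s, ∃ c ∉ 𝔮, c * g ∈ Ideal.span {x} := by
    intro g hg
    have hgS : algebraMap A S g ∈ Ideal.span {algebraMap A S x} := by
      rw [← h]; exact Ideal.mem_map_of_mem _ (hs ▸ Ideal.subset_span hg)
    rw [← Set.image_singleton, ← Ideal.map_span] at hgS
    obtain ⟨⟨a, c⟩, hac⟩ := (IsLocalization.mem_map_algebraMap_iff 𝔮.primeCompl S).mp hgS
    -- `g * c = a` in `S`, i.e. `t * (g * c) = t * a` for some `t ∉ 𝔮`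
    obtain ⟨t, ht⟩ := (IsLocalization.eq_iff_exists 𝔮.primeCompl S).mp
      (show algebraMap A S (g * c) = algebraMap A S a by
        rw [map_mul]; exact hac.symm ▸ rfl)
    refine ⟨t * c, fun hmem => ?_, ?_⟩
    · rcases ‹𝔮.IsPrime›.mem_or_mem hmem with h1 | h1
      · exact t.2 h1
      · exact c.2 h1
    · have : (t : A) * (c : A) * g = t * a := by rw [mul_assoc, mul_comm (c : A) g]; exact ht
      rw [this]
      exact Ideal.mul_mem_left _ _ a.2
  choose! c hc𝔮 hcx using hgen
  refine ⟨∏ g ∈ s, c g, fun hmem => ?_, fun T _ _ _ => ?_⟩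
  · obtain ⟨g, hg, hg𝔮⟩ := Ideal.IsPrime.prod_mem_iff.mp hmem
    exact hc𝔮 g hg hg𝔮
  · apply le_antisymm
    · rw [← hs, Ideal.map_span, Ideal.span_le]
      rintro _ ⟨g, hg, rfl⟩
      -- `g = (c_g g) / c_g` and `c_g` is a unit in `T` (it divides `e`)
      have hunit : IsUnit (algebraMap A T (c g)) := by
        have he : IsUnit (algebraMap A T (∏ g ∈ s, c g)) := IsLocalization.Away.algebraMap_isUnit _
        rw [map_prod] at he
        exact isUnit_of_dvd_unit (Finset.dvd_prod_of_mem (fun g => algebraMap A T (c g)) hg) he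
      have hmem : algebraMap A T (c g * g) ∈ Ideal.span {algebraMap A T x} := by
        have := Ideal.mem_map_of_mem (algebraMap A T) (hcx g hg)
        rwa [Ideal.map_span, Set.image_singleton] at this
      rw [map_mul] at hmem
      exact (Ideal.unit_mul_mem_iff_mem _ hunit).mp hmem
    · rw [Ideal.span_le, Set.singleton_subset_iff]
      exact Ideal.mem_map_of_mem _ hx

end Summit.ResolutionOfSingularities.ResolutionOfSingularities.Theorems.RadicialJung.CleanModels

end
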